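import Summits.QuantumAdvantage.QuantumAdvantage.Theorems.CubicForrelationNearExactIsExactSecondBoundaryLadder
import Summits.QuantumAdvantage.QuantumAdvantage.Theorems.CubicForrelationNearExactIsExactEightThirteenSixteenths
import Summits.QuantumAdvantage.QuantumAdvantage.Theorems.CubicForrelationNearExactIsExactEighteenBoundary
import Summits.QuantumAdvantage.QuantumAdvantage.Theorems.CubicForrelationNearExactIsExactTwentyBoundary
import Summits.QuantumAdvantage.QuantumAdvantage.Theorems.CubicForrelationNearExactIsExactTwoModSixSecondBoundary
import Summits.QuantumAdvantage.QuantumAdvantage.Theorems.CubicForrelationNearExactIsExactSixBoundary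

/-!
# Crux `CubicForrelation.NearExactIsExact` (stmt-QuantumAdvantage-14043) — the certified `θ_n` ladder, ONE index file
  (state of the tree 2026-08-20; what is proved at which `n`, with the deciding declaration for every row)

Certificate seat `b2b-cforr-cert` (gen 11).  HONEST FRAMING: this file adds NO new mathematics.  It packages, at the literal types
`Fin n`, the finite-slice DECIDABLE VERDICTS / kernel-checked THEOREMS the tree holds about the crux — so that a reader finds in one
place exactly what is proved at which `n` — and says what is NOT proved.  NOT summit progress: the crux asks for ONE `θ < 1` that
isolates exactness (`Φ(f,g) > θ ⇒ Φ(f,g) = 1`) for cubic pairs on EVERY even number of bits; every bound below tends to `1`, and the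
only bearing on the crux is the lower bound `θ ≥ 15/16` for any admissible constant (`le_of_isolates_ge_sixteen`).

Notation.  For even `n`, `θ_n` := the least real `θ` such that all cubic `f, g : 𝔽₂ⁿ → 𝔽₂` with `Φ(f,g) > θ` have `Φ(f,g) = 1`
(it exists and is a minimum: `theta_exists`; `θ_n` is non-decreasing in `n`: `theta_mono`; equivalently `θ_n` = the largest value
`Φ(f,g) < 1` of a cubic pair on `n` bits).  `Isol_n(c)` := "`Φ ≥ c ⇒ Φ = 1` for cubic pairs on `n` bits" (a CLOSED isolation
statement; it gives `θ_n < c`, `fb_theta_lt_of_closed`).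

## The table (every row kernel-checked; axioms `propext, Classical.choice, Quot.sound` unless marked ᶜ = additionally a compiled
## `native_decide` certificate run, i.e. `Lean.ofReduceBool`, proposed `--computational`)

| `n` | verdict | deciding declarations (namespace `…Theorems.CubicForrelation.NearExactIsExact`, file `Theorems/CubicForrelationNearExactIsExact<File>.lean`) |
|-----|---------|------------------------------------------------------------------------------------------------------------------------------------------|
| `2`  | `θ₂ = 1/2`ᶜ   | `theta_two_isLeast` (SixThetaExact; all `16 × 16` pairs by evaluation) |
| `4`  | `θ₄ = 3/4`ᶜ   | `theta_four_isLeast`, `isolation_four_34` (SixThetaExact; verified checker `cl_certify_sound` + `native_decide`) |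
| `6`  | `θ₆ = 25/32`ᶜ; `θ₆ < 7/8` with standard axioms | `theta_six_isLeast`, `isolation_six_2532`, value set top `{1, 25/32} ∪ (−∞, 3/4]` (SixThetaExact, SixValues; checker SixSyndrome/SixChecker/SixClasses); `isolation_six_closed` (SixBoundary) |
| `8`  | `θ₈ = 13/16`  | `theta_eight_isLeast`, `isolation_eight_1316` (EightThirteenSixteenths; chain Eight*) — witness the `𝔽₄`-pencil pair |
| `10` | `θ₁₀ = 7/8`   | `theta_ten_isLeast` (TenThetaExact), `isolation_ten_78` (TenIsolation78Final; second proof `isolation_ten_78_digital`, TenSevenEighths) — witness the `T`-family pair; `7/8` is the sharp constant at `n = 10` ONLY |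
| `12` | `θ₁₂ ∈ [57/64, 15/16)` | `theta_twelve_halfopen`, `isolation_twelve_closed` = `Isol₁₂(15/16)` (TwelveBoundary); record `57/64` (`Negative/F8ChainTwelve`) |
| `14` | `θ₁₄ ∈ [57/64, 31/32)` | `theta_fourteen_halfopen`, `isolation_fourteen_closed` = `Isol₁₄(31/32)` (FourteenBoundary); at the next boundary `15/16` only a STRUCTURE theorem: `second_boundary_structure_fourteen_sharp` (FourteenSecondStructureB), `fo_bent_false`, `fo_levelSeven_exact`; `θ₁₄ < 15/16` is OPEN |
| `16` | `θ₁₆ ∈ [15/16, 31/32)` | `theta_sixteen_halfopen`, `isolation_sixteen_closed` (SixteenBoundary); the record `Φ = 15/16 < 1` (`Negative/FifteenSixteenths`, `forrelation_f16_g16`) is why `7/8` is NOT the crux's constant |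
| `18` | `θ₁₈ ∈ [15/16, 63/64)` | `theta_eighteen_halfopen`, `isolation_eighteen_closed` (EighteenBoundary) |
| `20` | `θ₂₀ ∈ [15/16, 127/128)` | `theta_twenty_halfopen`, `isolation_twenty_closed` (TwentyBoundary); high levels even at `63/64`: `tw20_levels_exact` (TwentySecondLevelTen) |
| `22` | `θ₂₂ ∈ [15/16, 127/128)` | `theta_twentytwo_halfopen`, `isolation_twentytwo_closed` (FourModSixSecondBoundary) |
| `24` | `θ₂₄ ∈ [15/16, 255/256)` | `theta_twentyfour_halfopen`, `isolation_twentyfour_closed` (ZeroModSixSecondBoundary) |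
| `26` | `θ₂₆ ∈ [15/16, 511/512)` | `ls_theta_twentysix_halfopen` (THIS file, from `isolation_rate_closed_all`); high levels even at `255/256`: `isolation_twentysix_levels` |
| `28` | `θ₂₈ ∈ [15/16, 511/512)` | `ls_theta_twentyeight_halfopen` (THIS file, from `isolation_twentyeight_closed`, FourModSixSecondBoundary) |
| `30` | `θ₃₀ ∈ [15/16, 1023/1024)` | `ls_theta_thirty_halfopen` (THIS file, from `isolation_thirty_closed`, ZeroModSixSecondBoundary) |
| all even `n ≥ 6` | `Isol_n(1 − 2^{−⌊n/3⌋−1})`, i.e. `θ_n < 1 − 2^{−⌊n/3⌋−1}` | `isolation_rate_closed_all`, `theta_lt_rate_all` (SixBoundary; parts RateStrict, ZeroModSixBoundary, TwoModSixBoundary, FourModSixBoundary) |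
| `n ≥ 12`, `n ≡ 0, 4 (mod 6)` | `Isol_n(1 − 2^{−⌊n/3⌋})` (second dyadic boundary), i.e. `θ_n < 1 − 2^{−⌊n/3⌋}` | `isolation_closed_second_boundary`, `theta_lt_second_boundary` (SecondBoundaryLadder; parts TwelveBoundary, SixteenBoundary, ZeroModSixSecond*, FourModSixSecond*) |
| `n ≥ 14`, `n ≡ 2 (mod 6)` | second boundary OPEN; certified: high levels exact (`W_g ∈ 2^{⌊n/3⌋+3}ℤ ∧ Φ ≥ 1 − 2^{−⌊n/3⌋} ⇒ Φ = 1`) and a per-side structure theorem for `1 − 2^{−⌊n/3⌋} ≤ Φ < 1` | `isolation_two_mod_six_high_levels`, `second_boundary_side_two_mod_six`, `second_boundary_structure_two_mod_six` (TwoModSixSecondBoundary) |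
| all even `n ≥ 16` | `θ_n ≥ 15/16` | `le_of_isolates_ge_sixteen` (LadderEnvelope; padded `n = 16` witness, `theta_mono`) |
| crux | `NearExactIsExact ⟺ ∃ θ < 1 ∃ N ∀ even n ≥ N, θ isolates` | `nearExactIsExact_iff_eventually`, `le_of_isolates_eventually` (LadderEnvelope) |

Structured classes (not rows of the ladder; recorded for completeness): two-sided Maiorana–McFarland pairs with quadratic maps and cubic
offsets have `Φ = 1 ∨ Φ ≤ 31/32` at every `n` and `|Φ| ≤ 15/16` unless the maps are mutually inverse (`mg_mmPair_isolation`,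
`mg_mmPair_gap`, MmPairGap); bijective two-sided MM pairs at `n = 14` have `Φ = 1 ∨ Φ ≤ 7/8` (`Negative/BqqSeven`); a cubic BENT `g` on
14 bits has no cubic partner at `Φ = 15/16` (`fo_bent_false`) and the bent value `7/8` is attained there (`Negative/BentSevenEighthsFourteen`ᶜ).

WHAT IS OPEN (finite slices): `θ₁₂ ∈ [57/64, 15/16)` (47 candidate values `k/1024`), `θ₁₄ < 15/16` (residual branches: type O with
first-digit rank `≥ 4`, the all-cheap case, level `⌊n/3⌋+2` unbalanced — `TwoModSixSecondBoundary` docstring), every window above, and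
whether ANY cubic pair at any `n` has `Φ ∈ (15/16, 1)` (none is known; inside Maiorana–McFarland this is the `BQ-s` code question,
`Cruxes/NearExactIsExact/Disproof.lean`).  Nothing here is uniform in `n` with a constant `< 1`.

The theorems of this file are conjunctions / repackagings of the cited declarations (rows `26, 28, 30` are packaged here for the first
time, from the cited closed isolation statements, `theta_exists` and `le_of_isolates_ge_sixteen`).  Everything is proved from the tree;
axioms of every declaration below: `propext, Classical.choice, Quot.sound` (the ᶜ rows are only CITED in this docstring, not imported
into the statements below).

References: S. Aaronson, A. Ambainis, *Forrelation*, SIAM J. Comput. 47 (2018); C. Carlet, *Boolean Functions for Cryptography and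
Coding Theory* (CUP 2021) §5–6; J. Ax (1964) / R. J. McEliece (1972) (divisibility of Reed–Muller weights).
-/

set_option linter.dupNamespace false -- D-0017: single-problem summit ⇒ `QuantumAdvantage.QuantumAdvantage` by design

noncomputable section

namespace Summit.QuantumAdvantage.QuantumAdvantage.Theorems.CubicForrelation.NearExactIsExact

open Finset
open Literature.Computability.QuantumComplexity
open Literature.Computability.QuantumComplexity.DerivativeWalsh (W)

/-! ### A closed isolation statement at `n ≥ 16` gives the half-open row `θ_n ∈ [15/16, c)` -/

/-- **From `Isol_n(c)` to the row `θ_n ∈ [15/16, c)`** for even `n ≥ 16`: the least isolating threshold exists (`theta_exists`), is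
`≥ 15/16` (`le_of_isolates_ge_sixteen`) and is `< c` (`fb_theta_lt_of_closed`).  General packaging lemma. [this work] -/
theorem ls_halfopen_of_closed {n : ℕ} (hn : Even n) (h16 : 16 ≤ n) (c : ℝ)
    (hc : ∀ f g : (Fin n → Bool) → Bool, IsDegLeFun 3 f → IsDegLeFun 3 g → c ≤ forrelation f g → forrelation f g = 1) :
    ∃ θ₀ : ℝ, 15 / 16 ≤ θ₀ ∧ θ₀ < c ∧
      IsLeast {θ : ℝ | ∀ f g : (Fin n → Bool) → Bool, IsDegLeFun 3 f → IsDegLeFun 3 g →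
        θ < forrelation f g → forrelation f g = 1} θ₀ := by
  obtain ⟨θ₀, hθ₀⟩ := theta_exists n
  obtain ⟨θ', hθ', hiso⟩ := fb_theta_lt_of_closed (n := n) c hc
  exact ⟨θ₀, le_of_isolates_ge_sixteen hn h16 hθ₀.1, lt_of_le_of_lt (hθ₀.2 hiso) hθ', hθ₀⟩

/-! ### New packaged rows `n = 26, 28, 30` -/

/-- **On 26 bits, `Φ ≥ 511/512 ⇒ Φ = 1`** for all cubic `f, g : 𝔽₂²⁶ → 𝔽₂ (the uniform rate `1 − 2^{−⌊26/3⌋−1}` at the literal type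
`Fin 26`; `n = 26 ≡ 2 (mod 6)`, so the second boundary `255/256` is open except at high levels, `isolation_twentysix_levels`).
Finite-slice verdict; NOT summit progress. [this work] -/
theorem ls_isolation_twentysix_closed : ∀ f g : (Fin 26 → Bool) → Bool, IsDegLeFun 3 f → IsDegLeFun 3 g →
    (511 / 512 : ℝ) ≤ forrelation f g → forrelation f g = 1 := by
  intro f g hf hg hΦ
  exact isolation_rate_closed_all 26 (by decide) (by norm_num) f g hf hg (by norm_num; exact hΦ)

/-- **`θ₂₆ ∈ [15/16, 511/512)`.** NOT summit progress. [this work] -/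
theorem ls_theta_twentysix_halfopen : ∃ θ₀ : ℝ, 15 / 16 ≤ θ₀ ∧ θ₀ < 511 / 512 ∧
    IsLeast {θ : ℝ | ∀ f g : (Fin 26 → Bool) → Bool, IsDegLeFun 3 f → IsDegLeFun 3 g →
      θ < forrelation f g → forrelation f g = 1} θ₀ :=
  ls_halfopen_of_closed (by decide) (by norm_num) _ ls_isolation_twentysix_closed

/-- **`θ₂₈ ∈ [15/16, 511/512)`** (second dyadic boundary on `n ≡ 4 (mod 6)`, `isolation_twentyeight_closed`). NOT summit progress.
[this work] -/
theorem ls_theta_twentyeight_halfopen : ∃ θ₀ : ℝ, 15 / 16 ≤ θ₀ ∧ θ₀ < 511 / 512 ∧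
    IsLeast {θ : ℝ | ∀ f g : (Fin 28 → Bool) → Bool, IsDegLeFun 3 f → IsDegLeFun 3 g →
      θ < forrelation f g → forrelation f g = 1} θ₀ :=
  ls_halfopen_of_closed (by decide) (by norm_num) _ isolation_twentyeight_closed

/-- **`θ₃₀ ∈ [15/16, 1023/1024)`** (second dyadic boundary on `n ≡ 0 (mod 6)`, `isolation_thirty_closed`). NOT summit progress.
[this work] -/
theorem ls_theta_thirty_halfopen : ∃ θ₀ : ℝ, 15 / 16 ≤ θ₀ ∧ θ₀ < 1023 / 1024 ∧
    IsLeast {θ : ℝ | ∀ f g : (Fin 30 → Bool) → Bool, IsDegLeFun 3 f → IsDegLeFun 3 g →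
      θ < forrelation f g → forrelation f g = 1} θ₀ :=
  ls_halfopen_of_closed (by decide) (by norm_num) _ isolation_thirty_closed

/-! ### The ladder as ONE statement -/

/-- **The decided rows with standard axioms: `θ₈ = 13/16` and `θ₁₀ = 7/8`** (each an `IsLeast` statement at the literal type).  The rows
`θ₂ = 1/2`, `θ₄ = 3/4`, `θ₆ = 25/32` are decided too (`theta_two_isLeast`, `theta_four_isLeast`, `theta_six_isLeast`,
`…SixThetaExact.lean`) but rest on a compiled certificate run (`native_decide`) and are therefore only cited, not conjoined here.
NOT summit progress. [this work] -/
theorem ls_ladder_exact_rows :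
    IsLeast {θ : ℝ | ∀ f g : (Fin 8 → Bool) → Bool, IsDegLeFun 3 f → IsDegLeFun 3 g →
        θ < forrelation f g → forrelation f g = 1} (13 / 16) ∧
    IsLeast {θ : ℝ | ∀ f g : (Fin 10 → Bool) → Bool, IsDegLeFun 3 f → IsDegLeFun 3 g →
        θ < forrelation f g → forrelation f g = 1} (7 / 8) :=
  ⟨theta_eight_isLeast, theta_ten_isLeast⟩

/-- **The certified windows `θ_n ∈ [a_n, b_n)` for `n = 12, 14, …, 30`** (each: the least isolating threshold `θ₀` exists, `a_n ≤ θ₀ < b_n`):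
`[57/64, 15/16)`, `[57/64, 31/32)`, `[15/16, 31/32)`, `[15/16, 63/64)`, `[15/16, 127/128)`, `[15/16, 127/128)`, `[15/16, 255/256)`,
`[15/16, 511/512)`, `[15/16, 511/512)`, `[15/16, 1023/1024)`.  Every upper end is a dyadic boundary NOT attained; every lower end is an
attained value `< 1` (records `57/64` at `12, 14`; `15/16` at `16`, padded upward).  None of these windows is decided.  NOT summit
progress. [this work] -/
theorem ls_ladder_windows :
    (∃ θ₀ : ℝ, 57 / 64 ≤ θ₀ ∧ θ₀ < 15 / 16 ∧ IsLeast {θ : ℝ | ∀ f g : (Fin 12 → Bool) → Bool, IsDegLeFun 3 f → IsDegLeFun 3 g →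
        θ < forrelation f g → forrelation f g = 1} θ₀) ∧
    (∃ θ₀ : ℝ, 57 / 64 ≤ θ₀ ∧ θ₀ < 31 / 32 ∧ IsLeast {θ : ℝ | ∀ f g : (Fin 14 → Bool) → Bool, IsDegLeFun 3 f → IsDegLeFun 3 g →
        θ < forrelation f g → forrelation f g = 1} θ₀) ∧
    (∃ θ₀ : ℝ, 15 / 16 ≤ θ₀ ∧ θ₀ < 31 / 32 ∧ IsLeast {θ : ℝ | ∀ f g : (Fin 16 → Bool) → Bool, IsDegLeFun 3 f → IsDegLeFun 3 g →
        θ < forrelation f g → forrelation f g = 1} θ₀) ∧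
    (∃ θ₀ : ℝ, 15 / 16 ≤ θ₀ ∧ θ₀ < 63 / 64 ∧ IsLeast {θ : ℝ | ∀ f g : (Fin 18 → Bool) → Bool, IsDegLeFun 3 f → IsDegLeFun 3 g →
        θ < forrelation f g → forrelation f g = 1} θ₀) ∧
    (∃ θ₀ : ℝ, 15 / 16 ≤ θ₀ ∧ θ₀ < 127 / 128 ∧ IsLeast {θ : ℝ | ∀ f g : (Fin 20 → Bool) → Bool, IsDegLeFun 3 f → IsDegLeFun 3 g →
        θ < forrelation f g → forrelation f g = 1} θ₀) ∧
    (∃ θ₀ : ℝ, 15 / 16 ≤ θ₀ ∧ θ₀ < 127 / 128 ∧ IsLeast {θ : ℝ | ∀ f g : (Fin 22 → Bool) → Bool, IsDegLeFun 3 f → IsDegLeFun 3 g →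
        θ < forrelation f g → forrelation f g = 1} θ₀) ∧
    (∃ θ₀ : ℝ, 15 / 16 ≤ θ₀ ∧ θ₀ < 255 / 256 ∧ IsLeast {θ : ℝ | ∀ f g : (Fin 24 → Bool) → Bool, IsDegLeFun 3 f → IsDegLeFun 3 g →
        θ < forrelation f g → forrelation f g = 1} θ₀) ∧
    (∃ θ₀ : ℝ, 15 / 16 ≤ θ₀ ∧ θ₀ < 511 / 512 ∧ IsLeast {θ : ℝ | ∀ f g : (Fin 26 → Bool) → Bool, IsDegLeFun 3 f → IsDegLeFun 3 g →
        θ < forrelation f g → forrelation f g = 1} θ₀) ∧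
    (∃ θ₀ : ℝ, 15 / 16 ≤ θ₀ ∧ θ₀ < 511 / 512 ∧ IsLeast {θ : ℝ | ∀ f g : (Fin 28 → Bool) → Bool, IsDegLeFun 3 f → IsDegLeFun 3 g →
        θ < forrelation f g → forrelation f g = 1} θ₀) ∧
    (∃ θ₀ : ℝ, 15 / 16 ≤ θ₀ ∧ θ₀ < 1023 / 1024 ∧ IsLeast {θ : ℝ | ∀ f g : (Fin 30 → Bool) → Bool, IsDegLeFun 3 f → IsDegLeFun 3 g →
        θ < forrelation f g → forrelation f g = 1} θ₀) :=
  ⟨theta_twelve_halfopen, theta_fourteen_halfopen, theta_sixteen_halfopen, theta_eighteen_halfopen, theta_twenty_halfopen,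
    theta_twentytwo_halfopen, theta_twentyfour_halfopen, ls_theta_twentysix_halfopen, ls_theta_twentyeight_halfopen,
    ls_theta_thirty_halfopen⟩

/-- **The uniform statements** (infinitely many finite-slice verdicts, all constants tending to `1`): (i) the rate boundary is never
attained — for every even `n ≥ 6`, `Φ ≥ 1 − 2^{−⌊n/3⌋−1} ⇒ Φ = 1`; (ii) the second dyadic boundary is never attained on the classes
`n ≡ 0, 4 (mod 6)`, `n ≥ 12`: `Φ ≥ 1 − 2^{−⌊n/3⌋} ⇒ Φ = 1`; (iii) on `n ≡ 2 (mod 6)`, `n ≥ 14`, the same holds whenever one spectrum is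
divisible by `2^{⌊n/3⌋+3}` (the low levels / type O are the open residue); (iv) any `θ` isolating exactness at some even `n ≥ 16` is
`≥ 15/16`.  NOT summit progress (no constant `< 1` uniform in `n` is claimed). [this work] -/
theorem ls_ladder_uniform :
    (∀ n : ℕ, Even n → 6 ≤ n → ∀ f g : (Fin n → Bool) → Bool, IsDegLeFun 3 f → IsDegLeFun 3 g →
        1 - (1 / 2 : ℝ) ^ (n / 3 + 1) ≤ forrelation f g → forrelation f g = 1) ∧
    (∀ n : ℕ, (n % 6 = 0 ∨ n % 6 = 4) → 12 ≤ n → ∀ f g : (Fin n → Bool) → Bool, IsDegLeFun 3 f → IsDegLeFun 3 g →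
        1 - (1 / 2 : ℝ) ^ (n / 3) ≤ forrelation f g → forrelation f g = 1) ∧
    (∀ n : ℕ, n % 6 = 2 → 14 ≤ n → ∀ f g : (Fin n → Bool) → Bool, IsDegLeFun 3 f → IsDegLeFun 3 g →
        ∀ w : (Fin n → Bool) → ℤ, (∀ x, W (fun y => signOf (g y)) x = (2 : ℝ) ^ (n / 3 + 3) * (w x : ℝ)) →
        1 - (1 / 2 : ℝ) ^ (n / 3) ≤ forrelation f g → forrelation f g = 1) ∧
    (∀ (θ : ℝ) (n : ℕ), Even n → 16 ≤ n →
        (∀ f g : (Fin n → Bool) → Bool, IsDegLeFun 3 f → IsDegLeFun 3 g → θ < forrelation f g → forrelation f g = 1) →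
        15 / 16 ≤ θ) :=
  ⟨isolation_rate_closed_all, isolation_closed_second_boundary, isolation_two_mod_six_high_levels,
    fun _ _ hn h16 h => le_of_isolates_ge_sixteen hn h16 h⟩

end Summit.QuantumAdvantage.QuantumAdvantage.Theorems.CubicForrelation.NearExactIsExact

end
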